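import Summits.CriticalPhenomena.PercolationContinuityZ3.Theorems.PercNearOneGluingNoHeavyQuantGatedSliceMixLawExchange
import Summits.CriticalPhenomena.PercolationContinuityZ3.Theorems.PercNearOneGluingNoHeavyQuantFlowUncross
import HarnessLib

/-!
# QUANT lane R8, T-DEC, leg (III), blob case — the mixture side of `LawDec.GatedSliceMixLaw'`: the `W`-SIDE of the exchange when both atoms
# `h`, `h + a` of the weak-mid law are mids (`h + a ≤ j`) — a share of both mids absorbs a nonzero low (pair flows), and the capacity bound
# `K_i ≥ (S/h)(h − S)/(t − i)`

builds on p205010 (kernel theorem, internal audit signed; external expert review pending)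

Support file (`--supports stmt-CriticalPhenomena-4575`), QUANT lane typer seat prim-quant-stmt (gen 30), rung R8 of
`run/shared/lean/prim/quant/LADDER.md`.  Memo `run/shared/lean/prim/quant/prim-quant-stmt-g30/MIXLAW-MIXTURES-G30.md` §3–§4.  Theorems only,
standard axioms, no sorries.  Used by the regime files `…QuantGatedSliceMixLawC1`, `…QuantGatedSliceMixLawC2`.

THE `W`-SIDE (memo §3).  `W = W_h = w₀δ₀ + W(h)δ_h + W(h+a)δ_{h+a}` with `W(h) = (S/h)(1−g)`, `W(h+a) = (S/h)g`, both atoms mids (`h + a ≤ j`,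
`2h ≥ t`).  A nonzero `t`-low `i` of the moved law placed into these mids at the usage rates absorbs, per unit share of both mids,
`K_i = [t < i+h]·W(h)/usage(i,h) + W(h+a)/usage(i,h+a)` (the near mid only when compatible).  `flowAtT_weakMidShare`: the measure
`c·K_i·δ_i + c·W(h)·δ_h + c·W(h+a)·δ_{h+a}` is `FlowAtT` (two pair flows of `…QuantGatedSliceMixLawExchange`, or one and an idle mid).
`weakMid_capacity_ge`: with `usage(i,m)·(m − t) ≤ t − i` (`usage_mid_mul_le`) and `(1−g)(h−t) + g(h+a−t) = h − t + ag = h − S + agz ≥ h − S`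
(`t = S + ag(1−z)`), `K_i ≥ (S/h)(h − S)/(t − i)`: absorbing one unit of the low `i` through `W` costs at most `(t − i)/S` units of `W`'s
zero mass — the price bound behind the regime theorems.

* `LawDec.flowAtT_weakMidShare` — the share flow.
* `LawDec.weakMid_capacity_ge` — the capacity (price) bound.

[this work]; usage bounds: prim-quant-stmt g26 (`usage_mid_mul_le`), flow form g22 (this lane).  Nothing here is cited as a published result.
The gluing rows served [cite: KozmaNitzan2024, Conjecture 3 (p. 15)]; product measure [cite: Grimmett1999, §1.3 p. 10].
-/

noncomputable section

namespace Summit.CriticalPhenomena.PercolationContinuityZ3.Theorems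

namespace Quant

open Finset

/-- the two-point law `{lo, hi; g}` (as in `…QuantLawDEC`) -/
local notation3 "TP[" lo ", " hi ", " g ", " h "]" =>
  (g : ℝ) * (if (h : ℕ) = (hi : ℕ) then (1 : ℝ) else 0) + (1 - (g : ℝ)) * (if (h : ℕ) = (lo : ℕ) then (1 : ℝ) else 0)

namespace LawDec

/-! ### The `W`-side: a share of both mids of the weak-mid law absorbs a nonzero low -/

/-- **a share `c ≥ 0` of both mids `h`, `h+a` of `W_h` absorbs `c·K_i` of a nonzero `t`-low `i`** (`i ≤ j`, `2i < t`, `h + a ≤ j`, `h+a ≤ N`,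
`2h ≥ t`, `h + a > t + i`... i.e. `t < i + (h+a)`): with `K_i = [t < i+h]·W(h)/usage(i,h) + W(h+a)/usage(i,h+a)` the measure
`c·K_i·δ_i + c·W(h)·δ_h + c·W(h+a)·δ_{h+a}` is `FlowAtT` (two pair flows, or one pair flow and an idle mid). [this work] -/
theorem flowAtT_weakMidShare (y t S g c : ℝ) (j N h a i : ℕ) (hy0 : 0 < y) (hy1 : y < 1) (hg0 : 0 ≤ g) (hg1 : g ≤ 1)
    (hS0 : 0 ≤ S) (hc : 0 ≤ c)
    (hij : i ≤ j) (hilow : 2 * (i : ℝ) < t) (hhaN : h + a ≤ N) (hhmid : t ≤ 2 * (h : ℝ))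
    (hcompa : t < (i : ℝ) + ((h + a : ℕ) : ℝ)) :
    FlowAtT y t j N (fun p =>
      c * ((if t < (i : ℝ) + h then S / h * (1 - g) / usage y t j i h else 0) + S / h * g / usage y t j i (h + a))
          * (if p = i then (1 : ℝ) else 0)
        + c * (S / h * (1 - g)) * (if p = h then (1 : ℝ) else 0) + c * (S / h * g) * (if p = h + a then (1 : ℝ) else 0)) := by
  have hh0 : (0 : ℝ) ≤ h := Nat.cast_nonneg h
  have hSh' : 0 ≤ S / (h : ℝ) := div_nonneg hS0 hh0
  have hWh : 0 ≤ S / h * (1 - g) := mul_nonneg hSh' (by linarith)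
  have hWha : 0 ≤ S / h * g := mul_nonneg hSh' hg0
  have hiha : i < h + a := by
    have : (i : ℝ) < ((h + a : ℕ) : ℝ) := by
      have hi0 : (0 : ℝ) ≤ i := Nat.cast_nonneg i
      linarith
    exact_mod_cast this
  have hUa : 0 < usage y t j i (h + a) := usage_pos_of_compat y t j i (h + a) hy0 hy1 hilow hiha (Or.inr hcompa)
  -- the pair (i, h+a)
  have Pa := flowAtT_pair y t j N i (h + a) (c * (S / h * g / usage y t j i (h + a))) (c * (S / h * g)) hij hilow hhaN
    (Or.inr (by push_cast; linarith)) (Or.inr hcompa) (mul_nonneg hc (div_nonneg hWha hUa.le))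
    (le_of_eq (by field_simp))
  by_cases hci : t < (i : ℝ) + h
  · -- the pair (i, h)
    have hih : i < h := by
      have : (i : ℝ) < h := by nlinarith
      exact_mod_cast this
    have hUh : 0 < usage y t j i h := usage_pos_of_compat y t j i h hy0 hy1 hilow hih (Or.inr hci)
    have Ph := flowAtT_pair y t j N i h (c * (S / h * (1 - g) / usage y t j i h)) (c * (S / h * (1 - g))) hij hilow (by omega)
      (Or.inr hhmid) (Or.inr hci) (mul_nonneg hc (div_nonneg hWh hUh.le)) (le_of_eq (by field_simp))
    have := FlowAtT.add Ph Pa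
    refine (congrArg (FlowAtT y t j N) (funext fun p => ?_)).mp this
    rw [if_pos hci]; ring
  · -- the mid `h` idles
    have Ph := flowAtT_point y t j N h (c * (S / h * (1 - g))) (fun hc' => by linarith [hc'.2]) (mul_nonneg hc hWh)
    have := FlowAtT.add Ph Pa
    refine (congrArg (FlowAtT y t j N) (funext fun p => ?_)).mp this
    rw [if_neg hci]; ring

/-- **the capacity bound**: for a nonzero `t`-low `i` and the two mids of `W_h` (`h + a ≤ j`, `2h ≥ t`, `S < h`, `y(h+a) ≤ t`,
`t = S + ag(1−z)` with `agz ≥ 0`): `K_i ≥ (S/h)(h − S)/(t − i)` — from `usage(i,m)(m − t) ≤ t − i` (`usage_mid_mul_le`) and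
`(1−g)(h−t) + g(h+a−t) = h − t + ag ≥ h − S`. [this work] -/
theorem weakMid_capacity_ge (y t S g z : ℝ) (j h a i : ℕ) (hy0 : 0 < y) (hy1 : y < 1) (hg0 : 0 ≤ g) (hg1 : g ≤ 1) (hz0 : 0 ≤ z)
    (hS0 : 0 ≤ S) (hSh : S < (h : ℝ)) (ht : t = S + (a : ℝ) * g * (1 - z))
    (hilow : 2 * (i : ℝ) < t) (hhaj : h + a ≤ j) (htaa : y * ((h + a : ℕ) : ℝ) ≤ t) :
    S / h * ((h : ℝ) - S) / (t - i)
      ≤ (if t < (i : ℝ) + h then S / h * (1 - g) / usage y t j i h else 0) + S / h * g / usage y t j i (h + a) := by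
  have hh0 : (0 : ℝ) < h := lt_of_le_of_lt hS0 hSh
  have hSh' : 0 ≤ S / (h : ℝ) := div_nonneg hS0 hh0.le
  have hWh : 0 ≤ S / h * (1 - g) := mul_nonneg hSh' (by linarith)
  have hWha : 0 ≤ S / h * g := mul_nonneg hSh' hg0
  have hti : 0 < t - i := by linarith [(Nat.cast_nonneg i : (0 : ℝ) ≤ i)]
  have hagz : 0 ≤ (a : ℝ) * g * z := mul_nonneg (mul_nonneg (Nat.cast_nonneg a) hg0) hz0
  have hcompa : t < (i : ℝ) + ((h + a : ℕ) : ℝ) := by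
    push_cast
    have : (a : ℝ) * g * (1 - z) ≤ a := by
      have ha0 : (0 : ℝ) ≤ a := Nat.cast_nonneg a
      nlinarith [mul_nonneg ha0 hg0]
    linarith [(Nat.cast_nonneg i : (0 : ℝ) ≤ i)]
  have hiha : i < h + a := by
    have : (i : ℝ) < ((h + a : ℕ) : ℝ) := by linarith [(Nat.cast_nonneg i : (0 : ℝ) ≤ i)]
    exact_mod_cast this
  have hUa : 0 < usage y t j i (h + a) := usage_pos_of_compat y t j i (h + a) hy0 hy1 hilow hiha (Or.inr hcompa)
  -- the far mid: 1/usage ≥ (h+a−t)/(t−i)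
  have hfar : S / h * g * (((h + a : ℕ) : ℝ) - t) / (t - i) ≤ S / h * g / usage y t j i (h + a) := by
    have hmul := usage_mid_mul_le y t j i (h + a) hy0 hy1 hilow hhaj hcompa htaa
    rw [div_le_div_iff₀ hti hUa]
    calc S / h * g * (((h + a : ℕ) : ℝ) - t) * usage y t j i (h + a)
        = S / h * g * (usage y t j i (h + a) * (((h + a : ℕ) : ℝ) - t)) := by ring
      _ ≤ S / h * g * (t - i) := mul_le_mul_of_nonneg_left hmul hWha
  -- the near mid: 1/usage ≥ (h−t)/(t−i) when compatible, and (h − t) ≤ 0 otherwise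
  have hnear : S / h * (1 - g) * ((h : ℝ) - t) / (t - i)
      ≤ (if t < (i : ℝ) + h then S / h * (1 - g) / usage y t j i h else 0) := by
    by_cases hci : t < (i : ℝ) + h
    · rw [if_pos hci]
      have hih : i < h := by
        have : (i : ℝ) < h := by nlinarith
        exact_mod_cast this
      have hUh : 0 < usage y t j i h := usage_pos_of_compat y t j i h hy0 hy1 hilow hih (Or.inr hci)
      have htah : y * (h : ℝ) ≤ t := by
        have : (h : ℝ) ≤ ((h + a : ℕ) : ℝ) := by push_cast; linarith [(Nat.cast_nonneg a : (0 : ℝ) ≤ a)]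
        nlinarith
      have hmul := usage_mid_mul_le y t j i h hy0 hy1 hilow (by omega) hci htah
      rw [div_le_div_iff₀ hti hUh]
      calc S / h * (1 - g) * ((h : ℝ) - t) * usage y t j i h
          = S / h * (1 - g) * (usage y t j i h * ((h : ℝ) - t)) := by ring
        _ ≤ S / h * (1 - g) * (t - i) := mul_le_mul_of_nonneg_left hmul hWh
    · rw [if_neg hci]
      have hht : (h : ℝ) - t ≤ 0 := by linarith [(Nat.cast_nonneg i : (0 : ℝ) ≤ i)]
      exact div_nonpos_of_nonpos_of_nonneg (mul_nonpos_of_nonneg_of_nonpos hWh hht) hti.le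
  -- sum: (1−g)(h−t) + g(h+a−t) = h − t + ag = h − S + agz ≥ h − S
  have hsum : S / h * ((h : ℝ) - S) / (t - i)
      ≤ S / h * (1 - g) * ((h : ℝ) - t) / (t - i) + S / h * g * (((h + a : ℕ) : ℝ) - t) / (t - i) := by
    rw [← add_div]
    refine div_le_div_of_nonneg_right ?_ hti.le
    have e : S / h * (1 - g) * ((h : ℝ) - t) + S / h * g * (((h + a : ℕ) : ℝ) - t) = S / h * ((h : ℝ) - S + (a : ℝ) * g * z) := by
      push_cast; rw [ht]; ring
    rw [e]
    exact mul_le_mul_of_nonneg_left (by linarith) hSh'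
  linarith

end LawDec

end Quant

end Summit.CriticalPhenomena.PercolationContinuityZ3.Theorems
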